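import Summits.QuantumFields.YangMills.Theorems.Z2SelfDualityExpansions
import Literature.MathematicalPhysics.QuantumFieldTheory.AbelianTorusCochains
import HarnessLib

/-!
# The Kramers–Wannier dual map of four-dimensional `ℤ₂` lattice gauge theory on the torus

Support file for `…Theses.ModularSelfDualFold.Z2TorusFreeEnergySelfDuality`. In `d = 4` the
plaquettes of the torus `(ℤ/Mℤ)^4` are self-dual cells: the map
`π (z; a < b) = (z + e_a + e_b; c < d)`, `{c, d}` the two complementary directions (`dualPlaq`),
is a bijection of the plaquettes which carries the **edge–plaquette incidence** to the
**plaquette–cube incidence**: the six plaquettes containing the edge `(Y, ℓ)` are the images under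
`π` of the six faces of the `3`-cell with top corner `Y` spanned by the three directions other
than `ℓ` (`inc_eq_sum`, `td₂_ext_dualFn`). Consequently a plaquette set `S` is *even* (every edge
in an even number of its plaquettes: a closed surface of the high-temperature expansion) iff the
indicator function of `π⁻¹ S` is a *closed* `ℤ₂`-valued function of the plaquettes (`IsClosedPl`,
no flux out of any `3`-cell): `isClosedPl_dualFn_iff`; and the high-temperature sum over even sets
equals the sum of `t^{#supp η}` over closed plaquette functions: `evenSum_eq_closedSum`.
Everything here is proved (Wegner, J. Math. Phys. 12 (1971) 2259, §IV: the four-dimensional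
`ℤ₂` gauge theory is self-dual; Balian–Drouffe–Itzykson, Phys. Rev. D 11 (1975) 2098, §III.C).
-/

noncomputable section

namespace Summit.QuantumFields.YangMills.Theorems.Z2SelfDuality

open Finset
open Literature.MathematicalPhysics.QuantumFieldTheory
open Literature.MathematicalPhysics.QuantumFieldTheory.LatticeForm

/-! ### The two-element group `Additive ℤ₂` -/

/-- The additive form of the gauge group `ℤ₂` (the values of plaquette fields `plaqField U`). [folklore] -/
abbrev A2 : Type := Additive Z2

/-- The non-zero element of `Additive ℤ₂`. [folklore] -/
def u : A2 := Additive.ofMul (Multiplicative.ofAdd (1 : ZMod 2))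

/-- `Additive ℤ₂ = {0, u}`. [folklore] -/
theorem a2_eq_zero_or (a : A2) : a = 0 ∨ a = u := by
  revert a; decide

/-- `u ≠ 0`. [folklore] -/
theorem u_ne_zero : (u : A2) ≠ 0 := by decide

/-- `Additive ℤ₂` has exponent two: `-a = a`. [folklore] -/
theorem neg_eq_self_a2 (a : A2) : -a = a := by
  revert a; decide

/-- Subtraction is addition in `Additive ℤ₂`. [folklore] -/
theorem sub_eq_add_a2 (a b : A2) : a - b = a + b := by
  rw [sub_eq_add_neg, neg_eq_self_a2]

/-- `u + u = 0`. [folklore] -/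
theorem u_add_u : (u : A2) + u = 0 := by decide

/-- `n • u = 0` iff `n` is even. [folklore] -/
theorem nsmul_u_eq_zero_iff (n : ℕ) : n • (u : A2) = 0 ↔ Even n := by
  constructor
  · intro h
    by_contra hodd
    obtain ⟨m, rfl⟩ := Nat.not_even_iff_odd.1 hodd
    rw [add_nsmul, one_nsmul, mul_nsmul', two_nsmul, ← nsmul_add, u_add_u, nsmul_zero, zero_add] at h
    exact u_ne_zero h
  · rintro ⟨m, rfl⟩
    rw [add_nsmul, ← nsmul_add, u_add_u, nsmul_zero]

/-- The indicator `if c then u else 0` as a multiple of `u`. [folklore] -/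
theorem ite_u_eq_nsmul (c : Prop) [Decidable c] :
    (if c then (u : A2) else 0) = (if c then 1 else 0 : ℕ) • (u : A2) := by
  split_ifs <;> simp

/-! ### Index combinatorics in `Fin 4`: complementary and sorted pairs -/

/-- Sorted index pairs `a < b` (the plane labels of genuine plaquettes). [folklore] -/
abbrev PIdx : Type := {q : Fin 4 × Fin 4 // q.1 < q.2}

/-- The complementary pair of directions in `Fin 4`, in increasing order (junk on the
diagonal). [folklore] -/
def cplPair (q : Fin 4 × Fin 4) : Fin 4 × Fin 4 :=
  (if q.1 ≠ 0 ∧ q.2 ≠ 0 then 0 else if q.1 ≠ 1 ∧ q.2 ≠ 1 then 1 else 2,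
   if q.1 ≠ 3 ∧ q.2 ≠ 3 then 3 else if q.1 ≠ 2 ∧ q.2 ≠ 2 then 2 else 1)

/-- The complementary pair of a sorted pair is sorted. [folklore] -/
theorem cplPair_lt : ∀ q : Fin 4 × Fin 4, q.1 < q.2 → (cplPair q).1 < (cplPair q).2 := by decide

/-- The complementary plane label. [folklore] -/
def cpl (q : PIdx) : PIdx := ⟨cplPair q.1, cplPair_lt q.1 q.2⟩

/-- Complementation is an involution. [folklore] -/
theorem cpl_cpl : ∀ q : PIdx, cpl (cpl q) = q := by decide

/-- The pair `{a, b}` in increasing order. [folklore] -/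
def spPair (a b : Fin 4) : Fin 4 × Fin 4 := if a < b then (a, b) else (b, a)

/-- For `a ≠ b` the sorted pair is sorted. [folklore] -/
theorem spPair_lt : ∀ a b : Fin 4, a ≠ b → (spPair a b).1 < (spPair a b).2 := by decide

/-- The plane label `{a, b}` for `a ≠ b` (junk `(0,1)` for `a = b`). [folklore] -/
def sp (a b : Fin 4) : PIdx :=
  if h : a ≠ b then ⟨spPair a b, spPair_lt a b h⟩ else ⟨(0, 1), by decide⟩

/-- **The complement table**: for sorted `i < j < k` and the fourth direction `l`,
`cpl {j,k} = {l,i}`, `cpl {i,k} = {l,j}`, `cpl {i,j} = {l,k}`. [folklore] -/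
theorem cpl_faces : ∀ (i j k l : Fin 4) (hij : i < j) (hjk : j < k), l ≠ i → l ≠ j → l ≠ k →
    cpl ⟨(j, k), hjk⟩ = sp l i ∧ cpl ⟨(i, k), hij.trans hjk⟩ = sp l j ∧ cpl ⟨(i, j), hij⟩ = sp l k := by
  decide

/-- Every sorted triple has a fourth direction. [folklore] -/
theorem exists_fourth : ∀ i j k : Fin 4, i < j → j < k → ∃ l : Fin 4, l ≠ i ∧ l ≠ j ∧ l ≠ k := by decide

/-- Every direction is the fourth direction of a sorted triple. [folklore] -/
theorem exists_triple : ∀ l : Fin 4, ∃ i j k : Fin 4, i < j ∧ j < k ∧ l ≠ i ∧ l ≠ j ∧ l ≠ k := by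
  decide

/-- The directions other than the fourth one are the triple. [folklore] -/
theorem filter_ne_eq : ∀ (i j k l : Fin 4), i < j → j < k → l ≠ i → l ≠ j → l ≠ k →
    (Finset.univ.filter fun ν => ν ≠ l) = {i, j, k} := by decide

/-- A sorted pair containing `μ` is `{μ, ν}` for exactly one `ν ≠ μ`, namely its other entry:
first entry `μ`. [folklore] -/
theorem eq_sp_iff_of_fst : ∀ (r : PIdx) (ν : Fin 4), r.1.1 ≠ ν → (r = sp r.1.1 ν ↔ ν = r.1.2) := by decide

/-- Same with second entry `μ`. [folklore] -/
theorem eq_sp_iff_of_snd : ∀ (r : PIdx) (ν : Fin 4), r.1.2 ≠ ν → (r = sp r.1.2 ν ↔ ν = r.1.1) := by decide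

/-- `μ` is an entry of `{μ, ν}`. [folklore] -/
theorem entry_of_eq_sp : ∀ (r : PIdx) (μ ν : Fin 4), μ ≠ ν → r = sp μ ν → r.1.1 = μ ∨ r.1.2 = μ := by
  decide

/-- `{μ, ν}` determines `ν`. [folklore] -/
theorem sp_injective : ∀ (μ ν ν' : Fin 4), ν ≠ μ → ν' ≠ μ → sp μ ν = sp μ ν' → ν = ν' := by decide

/-! ### The dual map on plaquettes -/

variable {M : ℕ}

/-- **The Kramers–Wannier dual plaquette**: `π (z; q) = (z + e_{q₁} + e_{q₂}; cpl q)` — the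
plaquette of the dual lattice (identified with the lattice shifted by `(½,½,½,½)`) crossing
`(z; q)`. [cite: SeilerLNP1982, Ch. 1 (duality transformations)] -/
def dualPlaq (p : Plaquette 4 M) : Plaquette 4 M := (p.1 + te p.2.1.1 + te p.2.1.2, cpl p.2)

/-- The inverse dual map. [folklore] -/
def dualPlaqInv (p : Plaquette 4 M) : Plaquette 4 M :=
  (p.1 - te (cpl p.2).1.1 - te (cpl p.2).1.2, cpl p.2)

/-- `π ∘ π⁻¹ = id`. [folklore] -/
theorem dualPlaq_dualPlaqInv (p : Plaquette 4 M) : dualPlaq (dualPlaqInv p) = p := by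
  obtain ⟨z, q⟩ := p
  simp only [dualPlaq, dualPlaqInv, cpl_cpl, Prod.mk.injEq, and_true]
  abel

/-- `π⁻¹ ∘ π = id`. [folklore] -/
theorem dualPlaqInv_dualPlaq (p : Plaquette 4 M) : dualPlaqInv (dualPlaq p) = p := by
  obtain ⟨z, q⟩ := p
  simp only [dualPlaq, dualPlaqInv, cpl_cpl, Prod.mk.injEq, and_true]
  abel

/-- The dual map is injective. [folklore] -/
theorem dualPlaq_injective : Function.Injective (dualPlaq (M := M)) :=
  Function.LeftInverse.injective dualPlaqInv_dualPlaq

/-- **The dual plaquette function of a plaquette set**: the `ℤ₂`-valued indicator of `π⁻¹ S`,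
`dualFn S p = u` iff `π p ∈ S`. [folklore] -/
def dualFn (S : Finset (Plaquette 4 M)) : Plaquette 4 M → A2 :=
  fun p => if dualPlaq p ∈ S then u else 0

/-- The support of `dualFn S` is `π⁻¹ S`, of the same size as `S`. [folklore] -/
theorem card_support_dualFn [NeZero M] (S : Finset (Plaquette 4 M)) :
    (Finset.univ.filter fun p => dualFn S p ≠ 0).card = S.card := by
  classical
  have hset : (Finset.univ.filter fun p => dualFn S p ≠ 0) = S.image dualPlaqInv := by
    ext p
    simp only [Finset.mem_filter, Finset.mem_univ, true_and, Finset.mem_image, dualFn]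
    constructor
    · intro h
      have hp : dualPlaq p ∈ S := by by_contra h'; exact h (by simp [h'])
      exact ⟨dualPlaq p, hp, dualPlaqInv_dualPlaq p⟩
    · rintro ⟨p', hp', rfl⟩
      rw [dualPlaq_dualPlaqInv, if_pos hp']
      exact u_ne_zero
  rw [hset, Finset.card_image_of_injective _ (Function.LeftInverse.injective dualPlaq_dualPlaqInv)]

/-! ### Edge–plaquette incidence through the dual map -/

/-- **The plaquettes containing an edge.** The edge `(Y, μ)` lies on the plaquette `(z; r)` iff
`r = {μ, ν}` for some `ν ≠ μ` and `z ∈ {Y, Y - e_ν}`. [folklore] -/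
theorem mem_torusPlaqEdges_iff (Y : Site 4 M) (μ : Fin 4) (z : Site 4 M) (r : PIdx) :
    (Y, μ) ∈ torusPlaqEdges ((z, r) : Plaquette 4 M) ↔
      ∃ ν : Fin 4, ν ≠ μ ∧ r = sp μ ν ∧ (z = Y ∨ z = Y - te ν) := by
  have hr : r.1.1 ≠ r.1.2 := r.2.ne
  simp only [torusPlaqEdges, Site.shift, Finset.mem_insert, Finset.mem_singleton, Prod.mk.injEq]
  constructor
  · rintro (⟨h1, h2⟩ | ⟨h1, h2⟩ | ⟨h1, h2⟩ | ⟨h1, h2⟩)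
    · exact ⟨r.1.2, by rw [h2]; exact hr.symm, by rw [h2]; exact (eq_sp_iff_of_fst r r.1.2 hr).2 rfl,
        Or.inl h1.symm⟩
    · exact ⟨r.1.1, by rw [h2]; exact hr, by rw [h2]; exact (eq_sp_iff_of_snd r r.1.1 hr.symm).2 rfl,
        Or.inr (by rw [h1]; exact (add_sub_cancel_right z _).symm)⟩
    · exact ⟨r.1.2, by rw [h2]; exact hr.symm, by rw [h2]; exact (eq_sp_iff_of_fst r r.1.2 hr).2 rfl,
        Or.inr (by rw [h1]; exact (add_sub_cancel_right z _).symm)⟩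
    · exact ⟨r.1.1, by rw [h2]; exact hr, by rw [h2]; exact (eq_sp_iff_of_snd r r.1.1 hr.symm).2 rfl,
        Or.inl h1.symm⟩
  · rintro ⟨ν, hν, hr', hz⟩
    rcases entry_of_eq_sp r μ ν hν.symm hr' with hμ | hμ
    · have hν' : ν = r.1.2 := (eq_sp_iff_of_fst r ν (by rw [hμ]; exact hν.symm)).1 (by rw [hμ]; exact hr')
      rcases hz with hz | hz
      · exact Or.inl ⟨hz.symm, hμ.symm⟩
      · exact Or.inr (Or.inr (Or.inl ⟨by rw [hz, ← hν', sub_add_cancel], hμ.symm⟩))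
    · have hν' : ν = r.1.1 := (eq_sp_iff_of_snd r ν (by rw [hμ]; exact hν.symm)).1 (by rw [hμ]; exact hr')
      rcases hz with hz | hz
      · exact Or.inr (Or.inr (Or.inr ⟨hz.symm, hμ.symm⟩))
      · exact Or.inr (Or.inl ⟨by rw [hz, ← hν', sub_add_cancel], hμ.symm⟩)

/-- On a torus of side `M ≥ 2` the unit vectors are non-zero. [folklore] -/
theorem te_ne_zero [NeZero M] [Fact (1 < M)] (ν : Fin 4) : (te ν : Site 4 M) ≠ 0 := by
  intro h
  have := congrFun h ν
  simp [te] at this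

/-- **The incidence number through the dual cells** (`M ≥ 2`): the number of plaquettes of `S`
containing the edge `(Y, μ)` is `∑_{ν ≠ μ} ([(Y; {μ,ν}) ∈ S] + [(Y - e_ν; {μ,ν}) ∈ S])`. [folklore] -/
theorem inc_eq_sum [NeZero M] [Fact (1 < M)] (S : Finset (Plaquette 4 M)) (Y : Site 4 M) (μ : Fin 4) :
    inc S (Y, μ) = ∑ ν ∈ Finset.univ.filter (fun ν => ν ≠ μ),
      ((if ((Y, sp μ ν) : Plaquette 4 M) ∈ S then 1 else 0) +
        (if ((Y - te ν, sp μ ν) : Plaquette 4 M) ∈ S then 1 else 0)) := by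
  classical
  unfold inc
  have hdec : S.filter (fun p => ((Y, μ) : Edge 4 M) ∈ torusPlaqEdges p) =
      (Finset.univ.filter fun ν => ν ≠ μ).biUnion fun ν =>
        S.filter fun p => p = (Y, sp μ ν) ∨ p = (Y - te ν, sp μ ν) := by
    ext ⟨z, r⟩
    simp only [Finset.mem_filter, Finset.mem_biUnion, Finset.mem_univ, true_and,
      mem_torusPlaqEdges_iff, Prod.mk.injEq]
    constructor
    · rintro ⟨hS, ν, hν, hr, hz⟩
      refine ⟨ν, hν, hS, ?_⟩
      rcases hz with hz | hz
      · exact Or.inl ⟨hz, hr⟩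
      · exact Or.inr ⟨hz, hr⟩
    · rintro ⟨ν, hν, hS, h⟩
      refine ⟨hS, ν, hν, ?_⟩
      rcases h with ⟨hz, hr⟩ | ⟨hz, hr⟩
      · exact ⟨hr, Or.inl hz⟩
      · exact ⟨hr, Or.inr hz⟩
  rw [hdec, Finset.card_biUnion]
  · refine Finset.sum_congr rfl fun ν _ => ?_
    have hne : ((Y, sp μ ν) : Plaquette 4 M) ≠ (Y - te ν, sp μ ν) := by
      intro h
      have h1 : Y - te ν = Y := (congrArg Prod.fst h).symm
      exact te_ne_zero ν (sub_eq_self.1 h1)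
    rw [Finset.filter_or, Finset.card_union_of_disjoint
      (Finset.disjoint_filter.2 fun p _ h1 h2 => hne (h1.symm.trans h2)),
      Finset.filter_eq' S ((Y, sp μ ν) : Plaquette 4 M),
      Finset.filter_eq' S ((Y - te ν, sp μ ν) : Plaquette 4 M)]
    split_ifs <;> simp
  · intro ν hν ν' hν' hνν'
    have hν1 : ν ≠ μ := (Finset.mem_filter.1 hν).2
    have hν2 : ν' ≠ μ := (Finset.mem_filter.1 hν').2
    refine Finset.disjoint_filter.2 fun p _ h1 h2 => hνν' (sp_injective μ ν ν' hν1 hν2 ?_)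
    have e1 : p.2 = sp μ ν := by rcases h1 with h | h <;> rw [h]
    have e2 : p.2 = sp μ ν' := by rcases h2 with h | h <;> rw [h]
    exact e1.symm.trans e2

/-- **The flux of the dual function through a `3`-cell is the incidence number of `S` at the dual
edge**: for sorted directions `i < j < k` with fourth direction `l` and top corner
`Y = x + eᵢ + eⱼ + e_k`,
`td₂ (ext (dualFn S)) (x; i, j, k) = (∑_{ν ≠ l} ([(Y; {l,ν}) ∈ S] + [(Y - e_ν; {l,ν}) ∈ S])) • u`. [folklore] -/
theorem td₂_ext_dualFn [NeZero M] (S : Finset (Plaquette 4 M)) (x : Site 4 M) {i j k l : Fin 4}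
    (hij : i < j) (hjk : j < k) (hli : l ≠ i) (hlj : l ≠ j) (hlk : l ≠ k) :
    td₂ (ext (dualFn S)) x i j k =
      (∑ ν ∈ Finset.univ.filter (fun ν => ν ≠ l),
        ((if ((x + te i + te j + te k, sp l ν) : Plaquette 4 M) ∈ S then 1 else 0) +
          (if ((x + te i + te j + te k - te ν, sp l ν) : Plaquette 4 M) ∈ S then 1 else 0))) • (u : A2) := by
  classical
  obtain ⟨h1, h2, h3⟩ := cpl_faces i j k l hij hjk hli hlj hlk
  rw [td₂_ext_sorted _ x hij hjk]
  have e1 : dualFn S (x + te i, ⟨(j, k), hjk⟩) =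
      if ((x + te i + te j + te k, sp l i) : Plaquette 4 M) ∈ S then u else 0 := by
    simp only [dualFn, dualPlaq, h1]
  have e2 : dualFn S (x, ⟨(j, k), hjk⟩) =
      if ((x + te i + te j + te k - te i, sp l i) : Plaquette 4 M) ∈ S then u else 0 := by
    simp only [dualFn, dualPlaq, h1]
    have : x + te j + te k = x + te i + te j + te k - te i := by abel
    rw [this]
  have e3 : dualFn S (x + te j, ⟨(i, k), hij.trans hjk⟩) =
      if ((x + te i + te j + te k, sp l j) : Plaquette 4 M) ∈ S then u else 0 := by
    simp only [dualFn, dualPlaq, h2]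
    have : x + te j + te i + te k = x + te i + te j + te k := by abel
    rw [this]
  have e4 : dualFn S (x, ⟨(i, k), hij.trans hjk⟩) =
      if ((x + te i + te j + te k - te j, sp l j) : Plaquette 4 M) ∈ S then u else 0 := by
    simp only [dualFn, dualPlaq, h2]
    have : x + te i + te k = x + te i + te j + te k - te j := by abel
    rw [this]
  have e5 : dualFn S (x + te k, ⟨(i, j), hij⟩) =
      if ((x + te i + te j + te k, sp l k) : Plaquette 4 M) ∈ S then u else 0 := by
    simp only [dualFn, dualPlaq, h3]
    have : x + te k + te i + te j = x + te i + te j + te k := by abel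
    rw [this]
  have e6 : dualFn S (x, ⟨(i, j), hij⟩) =
      if ((x + te i + te j + te k - te k, sp l k) : Plaquette 4 M) ∈ S then u else 0 := by
    simp only [dualFn, dualPlaq, h3]
    rw [show x + te i + te j + te k - te k = x + te i + te j by abel]
  rw [e1, e2, e3, e4, e5, e6, filter_ne_eq i j k l hij hjk hli hlj hlk,
    Finset.sum_insert (by simp [hij.ne, (hij.trans hjk).ne]), Finset.sum_insert (by simp [hjk.ne]),
    Finset.sum_singleton]
  simp only [sub_eq_add_a2, ite_u_eq_nsmul, ← add_nsmul]
  congr 1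
  ring

/-- **Even plaquette sets are exactly those with closed dual function** (`M ≥ 2`): `S` has even
incidence at every edge iff `dualFn S` has no flux out of any `3`-cell. [cite: SeilerLNP1982, Ch. 1 (duality transformations)] -/
theorem isClosedPl_dualFn_iff [NeZero M] [Fact (1 < M)] (S : Finset (Plaquette 4 M)) :
    IsClosedPl (dualFn S) ↔ ∀ e : Edge 4 M, Even (inc S e) := by
  constructor
  · rintro h ⟨Y, l⟩
    obtain ⟨i, j, k, hij, hjk, hli, hlj, hlk⟩ := exists_triple l
    have h0 := h (Y - te i - te j - te k) i j k
    rw [td₂_ext_dualFn S _ hij hjk hli hlj hlk] at h0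
    have hY : Y - te i - te j - te k + te i + te j + te k = Y := by abel
    rw [hY, ← inc_eq_sum] at h0
    exact (nsmul_u_eq_zero_iff _).1 h0
  · intro h x a b c
    refine td₂_eq_zero_of_sorted (isAlt_ext _) (fun y i j k hij hjk => ?_) x a b c
    obtain ⟨l, hli, hlj, hlk⟩ := exists_fourth i j k hij hjk
    rw [td₂_ext_dualFn S y hij hjk hli hlj hlk, ← inc_eq_sum]
    exact (nsmul_u_eq_zero_iff _).2 (h _)

/-! ### The high-temperature sum equals the sum over closed plaquette functions -/

/-- The dual function of the dual support is the function: `dualFn (π (supp η)) = η`. [folklore] -/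
theorem dualFn_image_support [NeZero M] (η : Plaquette 4 M → A2) :
    dualFn ((Finset.univ.filter fun p => η p ≠ 0).image dualPlaq) = η := by
  classical
  funext p
  have hmem : dualPlaq p ∈ (Finset.univ.filter fun p => η p ≠ 0).image dualPlaq ↔ η p ≠ 0 := by
    rw [Finset.mem_image]
    constructor
    · rintro ⟨p', hp', hpp'⟩
      rw [dualPlaq_injective hpp'] at hp'
      exact (Finset.mem_filter.1 hp').2
    · intro hp
      exact ⟨p, Finset.mem_filter.2 ⟨Finset.mem_univ _, hp⟩, rfl⟩
  unfold dualFn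
  by_cases hp : η p = 0
  · rw [if_neg (fun h' => (hmem.1 h') hp), hp]
  · rw [if_pos (hmem.2 hp), ((a2_eq_zero_or (η p)).resolve_left hp)]

/-- The dual support of the dual function is the set: `π (supp (dualFn S)) = S`. [folklore] -/
theorem image_support_dualFn [NeZero M] (S : Finset (Plaquette 4 M)) :
    (Finset.univ.filter fun p => dualFn S p ≠ 0).image dualPlaq = S := by
  classical
  ext p
  simp only [Finset.mem_image, Finset.mem_filter, Finset.mem_univ, true_and, dualFn, ne_eq,
    ite_eq_right_iff, u_ne_zero, imp_false, not_not]
  constructor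
  · rintro ⟨p', hp', rfl⟩; exact hp'
  · intro hp
    exact ⟨dualPlaqInv p, by rw [dualPlaq_dualPlaqInv]; exact hp, dualPlaq_dualPlaqInv p⟩

open Classical in
/-- The **sum over closed plaquette functions** `A(t) = ∑_{η closed} t^{#supp η}`, `η` ranging
over the `ℤ₂`-valued functions of the genuine plaquettes of `(ℤ/Mℤ)^4` with no flux out of any
`3`-cell. [folklore] -/
def closedSum (M : ℕ) [NeZero M] (t : ℝ) : ℝ :=
  ∑ η ∈ (Finset.univ : Finset (Plaquette 4 M → A2)).filter (fun η => IsClosedPl η), suppWeight t η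

/-- **Kramers–Wannier duality on the self-dual cells** (`d = 4`, `M ≥ 2`): the high-temperature
sum over even plaquette sets equals the sum over closed plaquette functions,
`∑_{S even} t^{#S} = ∑_{η closed} t^{#supp η}`. [cite: SeilerLNP1982, Ch. 1 (duality transformations)] -/
theorem evenSum_eq_closedSum [NeZero M] [Fact (1 < M)] (t : ℝ) : evenSum 4 M t = closedSum M t := by
  classical
  unfold evenSum closedSum
  refine Finset.sum_nbij' (fun S => dualFn S)
    (fun η => (Finset.univ.filter fun p => η p ≠ 0).image dualPlaq) ?_ ?_ ?_ ?_ ?_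
  · intro S hS
    exact Finset.mem_filter.2 ⟨Finset.mem_univ _, (isClosedPl_dualFn_iff S).2 (mem_evenSets.1 hS)⟩
  · intro η hη
    have hcl : IsClosedPl η := (Finset.mem_filter.1 hη).2
    rw [mem_evenSets, ← isClosedPl_dualFn_iff, dualFn_image_support]
    exact hcl
  · intro S _
    exact image_support_dualFn S
  · intro η _
    exact dualFn_image_support η
  · intro S _
    rw [suppWeight, card_support_dualFn]

end Summit.QuantumFields.YangMills.Theorems.Z2SelfDuality
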